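import Summits.Ventures.PercRepro.S1CFCapsLineTwo

/-!
# PercRepro — `Q₄² ≤ 41` UNCONDITIONALLY, `Q₄² ≤ 33` WITH FIVE DEPENDENT PAIRS, `Q₃¹ ≤ 1` WITH AT MOST FIVE (p1, gen 37)

The assembly of the cap `Q₄²` of p7's ν = 4 program. **`ncard_three_eRk_le_one_le_one_of_le_five`**: with `D₂ ≤ 5` the
rank-`1` triples all lie in one class, of `≤ 3` points (a class of `4` carries `6` dependent pairs): `Q₃¹ ≤ 1`.
**`ncard_four_eRk_le_two_le_of_five_le`**: with `D₂ ≥ 5` every `4`-set of rank `≤ 2` meets the class `F` of `4` in `≥ 3`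
points (it contains a dependent pair `P ⊆ F`; a point of `X ∖ P` outside `F` would give a triangle through `p`, and there are
none by LEMMA K): `Q₄² ≤ C(4, 3)·C(8, 1) + C(4, 4) = 33`. **`ncard_four_eRk_le_two_le_fortyone`**: `Q₄² ≤ 41` — `D₂ ≤ 3`:
`5 + 9·1 + 9 + 18`; `D₂ = 4`: `5 + 9·1 + 16` (no triangles); `D₂ ≥ 5`: `33`. Nothing about any cell is claimed. Axioms: standard.
-/

open scoped Matroid

namespace PercRepro

namespace S1CF

open Set

variable {α : Type}

/-- **`D₂ ≤ 5 ⇒ Q₃¹ ≤ 1`**: the rank-`1` triples lie in one class of at most `3` points. -/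
theorem ncard_three_eRk_le_one_le_one_of_le_five (M : Matroid α) [M.Finite] (hL : ∀ e ∈ M.E, ¬ M.IsLoop e)
    (hK : ∀ e, ¬ M.IsColoop e) (hd : M.E.encard = M.eRank + ((4 : ℕ) : ℕ∞)) (hn : M.E.ncard = 12)
    (h5 : {P : Set α | P ⊆ M.E ∧ P.ncard = 2 ∧ M.Dep P}.ncard ≤ 5) :
    {X : Set α | X ⊆ M.E ∧ X.ncard = 3 ∧ M.eRk X ≤ 1}.ncard ≤ 1 := by
  classical
  have hEfin := M.ground_finite
  set 𝒬 := {X : Set α | X ⊆ M.E ∧ X.ncard = 3 ∧ M.eRk X ≤ 1} with h𝒬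
  rcases 𝒬.eq_empty_or_nonempty with hemp | ⟨X₀, hX₀⟩
  · rw [hemp]; simp
  obtain ⟨hX₀E, hX₀3, hX₀r⟩ := hX₀
  have hX₀fin : X₀.Finite := hEfin.subset hX₀E
  obtain ⟨x, hxX₀⟩ : X₀.Nonempty := by rw [← Set.ncard_pos hX₀fin, hX₀3]; norm_num
  have hxE : x ∈ M.E := hX₀E hxX₀
  set F := M.closure {x} with hFdef
  have hF : F ⊆ M.E := M.closure_subset_ground _
  have hFfin : F.Finite := hEfin.subset hF
  have hF4 : F.ncard ≤ 4 := ncard_closure_singleton_le_four M hK hd hn x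
  have hX₀F : X₀ ⊆ F := subset_closure_singleton_of_eRk_le_one M hL hX₀E hX₀r hxX₀
  have hFr : M.eRk F ≤ 1 := eRk_le_one_of_subset_closure_singleton M (subset_refl _)
  have hsub : 𝒬 ⊆ {X : Set α | X ⊆ F ∧ X.ncard = 3} := by
    intro X hX
    obtain ⟨hXE, hX3, hXr⟩ := hX
    refine ⟨?_, hX3⟩
    rcases (X ∩ F).eq_empty_or_nonempty with hemp | ⟨x', hx'X, hx'F⟩
    · exfalso
      have hXfin : X.Finite := hEfin.subset hXE
      have hdisj : Disjoint X₀ X := by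
        rw [Set.disjoint_left]
        intro w hw hwX
        have : w ∈ X ∩ F := ⟨hwX, hX₀F hw⟩
        rw [hemp] at this
        exact this
      have hcard : (X₀ ∪ X).ncard = 6 := by
        rw [Set.ncard_union_eq hdisj hX₀fin hXfin]; omega
      have hU : X₀ ∪ X ⊆ M.E := union_subset hX₀E hXE
      have hr : M.eRk (X₀ ∪ X) ≤ 2 := by
        calc M.eRk (X₀ ∪ X) ≤ M.eRk X₀ + M.eRk X := M.eRk_union_le_eRk_add_eRk X₀ X
          _ ≤ 1 + 1 := add_le_add hX₀r hXr
          _ = 2 := by norm_num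
      have hr' := eRk_toNat_le_of_eRk_le M hU (m := 2) (by exact_mod_cast hr)
      have := ncard_le_eRk_toNat_add_three M hK hd hn hU (by omega)
      omega
    · have hx'E : x' ∈ M.E := hXE hx'X
      have h1 : X ⊆ M.closure {x'} := subset_closure_singleton_of_eRk_le_one M hL hXE hXr hx'X
      have h2 : M.closure {x'} = F :=
        closure_singleton_eq_of_mem_closure_singleton M hxE (hL x hxE) hx'F (hL x' hx'E)
      rw [← h2]; exact h1
  -- `|F| ≤ 3`: a class of `4` carries `6` dependent pairs
  have hF3 : F.ncard ≤ 3 := by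
    by_contra h
    push Not at h
    have hpairs : {P : Set α | P ⊆ F ∧ P.ncard = 2} ⊆ {P : Set α | P ⊆ M.E ∧ P.ncard = 2 ∧ M.Dep P} := by
      intro P hP
      obtain ⟨hPF, hP2⟩ := hP
      refine ⟨hPF.trans hF, hP2, ?_⟩
      have hPfin : P.Finite := hFfin.subset hPF
      rw [← Matroid.eRk_lt_encard_iff_dep_of_finite hPfin (hPF.trans hF), ← hPfin.cast_ncard_eq, hP2]
      exact lt_of_le_of_lt ((M.eRk_mono hPF).trans hFr) (by norm_num)
    have h6 : 6 ≤ {P : Set α | P ⊆ F ∧ P.ncard = 2}.ncard := by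
      rw [ncard_subsets_eq_choose hFfin 2]
      have : F.ncard = 4 := by omega
      rw [this]; decide
    have := Set.ncard_le_ncard hpairs (hEfin.finite_subsets.subset (fun P hP => hP.1))
    omega
  calc 𝒬.ncard ≤ {X : Set α | X ⊆ F ∧ X.ncard = 3}.ncard :=
        Set.ncard_le_ncard hsub (hFfin.finite_subsets.subset (fun X hX => hX.1))
    _ = F.ncard.choose 3 := ncard_subsets_eq_choose hFfin 3
    _ ≤ (3 : ℕ).choose 3 := Nat.choose_le_choose 3 hF3
    _ = 1 := by decide

/-- **`D₂ ≥ 5 ⇒ Q₄² ≤ 33`**: every `4`-set of rank `≤ 2` meets the class of `4` in at least three points. -/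
theorem ncard_four_eRk_le_two_le_of_five_le (M : Matroid α) [M.Finite] (hL : ∀ e ∈ M.E, ¬ M.IsLoop e)
    (hK : ∀ e, ¬ M.IsColoop e) (hd : M.E.encard = M.eRank + ((4 : ℕ) : ℕ∞)) (hn : M.E.ncard = 12)
    (h5 : 5 ≤ {P : Set α | P ⊆ M.E ∧ P.ncard = 2 ∧ M.Dep P}.ncard) :
    {X : Set α | X ⊆ M.E ∧ X.ncard = 4 ∧ M.eRk X ≤ 2}.ncard ≤ 33 := by
  classical
  have hEfin := M.ground_finite
  obtain ⟨P₀, hP₀⟩ : {P : Set α | P ⊆ M.E ∧ P.ncard = 2 ∧ M.Dep P}.Nonempty := by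
    rw [← Set.ncard_pos (hEfin.finite_subsets.subset (fun P hP => hP.1))]; omega
  obtain ⟨hP₀E, hP₀2, hP₀dep⟩ := hP₀
  obtain ⟨x, y, hxy, rfl⟩ := Set.ncard_eq_two.1 hP₀2
  have hxE : x ∈ M.E := hP₀E (by simp)
  have hyE : y ∈ M.E := hP₀E (by simp)
  obtain ⟨hF4, hall⟩ := closure_singleton_of_five_dep_pairs M hL hK hd hn h5 hxy hxE hyE hP₀dep
  set F := M.closure {x} with hFdef
  have hF : F ⊆ M.E := M.closure_subset_ground _
  have hEF : (M.E \ F).ncard = 8 := by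
    have := Set.ncard_sdiff_add_ncard_of_subset hF hEfin
    omega
  have hsub : {X : Set α | X ⊆ M.E ∧ X.ncard = 4 ∧ M.eRk X ≤ 2} ⊆
      {X : Set α | X ⊆ M.E ∧ X.ncard = 4 ∧ (X ∩ F).ncard = 3} ∪
        {X : Set α | X ⊆ M.E ∧ X.ncard = 4 ∧ (X ∩ F).ncard = 4} := by
    intro X hX
    obtain ⟨hXE, hX4, hXr⟩ := hX
    have hXfin : X.Finite := hEfin.subset hXE
    -- every dependent 3-subset of `X` contains a dependent pair (no triangles)
    have hno3 : ∀ T ⊆ X, T.ncard = 3 → ∃ P ⊆ T, P.ncard = 2 ∧ M.Dep P := by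
      intro T hTX hT3
      by_contra hno
      push Not at hno
      have hTdep : M.Dep T := by
        have hfin : T.Finite := hXfin.subset hTX
        rw [← Matroid.eRk_lt_encard_iff_dep_of_finite hfin (hTX.trans hXE), ← hfin.cast_ncard_eq, hT3]
        exact lt_of_le_of_lt (M.eRk_mono hTX) (lt_of_le_of_lt hXr (by norm_num))
      have hc := isCircuit_of_dep_three_of_no_dep_pair M (hTX.trans hXE) hT3 hTdep hno
      exact not_isCircuit_of_four_le_ncard_dep_pairs M hL hK hd hn (by omega) hc (by omega) (by omega)
    -- a dependent pair `P ⊆ X`, inside `F`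
    obtain ⟨e, he⟩ : X.Nonempty := by rw [← Set.ncard_pos hXfin, hX4]; norm_num
    obtain ⟨P, hPT, hP2, hPdep⟩ := hno3 (X \ {e}) sdiff_subset (by rw [Set.ncard_sdiff_singleton_of_mem he, hX4])
    have hPX : P ⊆ X := hPT.trans sdiff_subset
    have hPF : P ⊆ F := hall P (hPX.trans hXE) hP2 hPdep
    obtain ⟨p, p', hpp', rfl⟩ := Set.ncard_eq_two.1 hP2
    have hpE : p ∈ M.E := hXE (hPX (by simp))
    have hpF : p ∈ F := hPF (by simp)
    -- a third point of `X` in `F`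
    have h3 : 3 ≤ (X ∩ F).ncard := by
      by_contra hlt
      push Not at hlt
      -- then `X ∖ P` is outside `F` and `{p} ∪ (X ∖ P)` is a triangle
      have hXP2 : (X \ {p, p'}).ncard = 2 := by
        have := Set.ncard_sdiff_add_ncard_of_subset hPX hXfin
        rw [Set.ncard_pair hpp'] at this
        omega
      have hout : ∀ w ∈ X \ {p, p'}, w ∉ F := by
        intro w hw hwF
        apply absurd hlt
        push Not
        have : insert w {p, p'} ⊆ X ∩ F := by
          intro z hz
          rcases hz with rfl | hz
          · exact ⟨hw.1, hwF⟩
          · exact ⟨hPX hz, hPF hz⟩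
        have h3' : (insert w {p, p'} : Set α).ncard = 3 := by
          rw [Set.ncard_insert_of_notMem hw.2, Set.ncard_pair hpp']
        rw [← h3']
        exact Set.ncard_le_ncard this (hXfin.subset inter_subset_left)
      set T := insert p (X \ {p, p'}) with hTdef
      have hTX : T ⊆ X := Set.insert_subset (hPX (by simp)) sdiff_subset
      have hpT : p ∉ X \ {p, p'} := fun h => h.2 (by simp)
      have hT3 : T.ncard = 3 := by rw [hTdef, Set.ncard_insert_of_notMem hpT (hXfin.subset sdiff_subset), hXP2]
      obtain ⟨Q, hQT, hQ2, hQdep⟩ := hno3 T hTX hT3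
      have hQF : Q ⊆ F := hall Q ((hQT.trans hTX).trans hXE) hQ2 hQdep
      -- `Q` has a point of `X ∖ P` (it is not `{p}` alone), which lies outside `F`
      obtain ⟨a, b, hab, rfl⟩ := Set.ncard_eq_two.1 hQ2
      have hone : ∃ w ∈ ({a, b} : Set α), w ∈ X \ {p, p'} := by
        by_contra hcon
        push Not at hcon
        have ha : a = p := by
          rcases hQT (by simp : a ∈ ({a, b} : Set α)) with h | h
          · exact h
          · exact absurd h (hcon a (by simp))
        have hb : b = p := by
          rcases hQT (by simp : b ∈ ({a, b} : Set α)) with h | h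
          · exact h
          · exact absurd h (hcon b (by simp))
        exact hab (ha.trans hb.symm)
      obtain ⟨w, hwQ, hw⟩ := hone
      exact hout w hw (hQF hwQ)
    have h4 : (X ∩ F).ncard ≤ 4 := by
      rw [← hX4]; exact Set.ncard_le_ncard inter_subset_left hXfin
    rcases Nat.lt_or_ge (X ∩ F).ncard 4 with hlt | hge
    · exact Or.inl ⟨hXE, hX4, by omega⟩
    · exact Or.inr ⟨hXE, hX4, by omega⟩
  have hc3 := ncard_inter_eq_le hEfin hF 4 3
  have hc4 := ncard_inter_eq_le hEfin hF 4 4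
  rw [hF4, hEF] at hc3 hc4
  norm_num at hc3 hc4
  have hfin : ∀ i, {X : Set α | X ⊆ M.E ∧ X.ncard = 4 ∧ (X ∩ F).ncard = i}.Finite :=
    fun _ => hEfin.finite_subsets.subset (fun X hX => hX.1)
  calc {X : Set α | X ⊆ M.E ∧ X.ncard = 4 ∧ M.eRk X ≤ 2}.ncard
      ≤ ({X : Set α | X ⊆ M.E ∧ X.ncard = 4 ∧ (X ∩ F).ncard = 3} ∪
          {X : Set α | X ⊆ M.E ∧ X.ncard = 4 ∧ (X ∩ F).ncard = 4}).ncard :=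
        Set.ncard_le_ncard hsub ((hfin 3).union (hfin 4))
    _ ≤ {X : Set α | X ⊆ M.E ∧ X.ncard = 4 ∧ (X ∩ F).ncard = 3}.ncard +
          {X : Set α | X ⊆ M.E ∧ X.ncard = 4 ∧ (X ∩ F).ncard = 4}.ncard := Set.ncard_union_le _ _
    _ ≤ 32 + 1 := by gcongr
    _ = 33 := by norm_num

/-- **`Q₄² ≤ 41`** unconditionally. -/
theorem ncard_four_eRk_le_two_le_fortyone (M : Matroid α) [M.Finite] (hL : ∀ e ∈ M.E, ¬ M.IsLoop e)
    (hK : ∀ e, ¬ M.IsColoop e) (hd : M.E.encard = M.eRank + ((4 : ℕ) : ℕ∞)) (hn : M.E.ncard = 12) :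
    {X : Set α | X ⊆ M.E ∧ X.ncard = 4 ∧ M.eRk X ≤ 2}.ncard ≤ 41 := by
  rcases Nat.lt_or_ge {P : Set α | P ⊆ M.E ∧ P.ncard = 2 ∧ M.Dep P}.ncard 4 with hlt | hge
  · have hs := ncard_four_eRk_le_two_le_split M hL hK hd hn
    have hq := ncard_three_eRk_le_one_le_one_of_le_five M hL hK hd hn (by omega)
    have hd3 : {P : Set α | P ⊆ M.E ∧ P.ncard = 2 ∧ M.Dep P}.ncard ≤ 3 := by omega
    have hsq : {P : Set α | P ⊆ M.E ∧ P.ncard = 2 ∧ M.Dep P}.ncard *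
        {P : Set α | P ⊆ M.E ∧ P.ncard = 2 ∧ M.Dep P}.ncard ≤ 3 * 3 :=
      Nat.mul_le_mul hd3 hd3
    omega
  rcases Nat.lt_or_ge {P : Set α | P ⊆ M.E ∧ P.ncard = 2 ∧ M.Dep P}.ncard 5 with hlt' | hge'
  · have hs := ncard_four_eRk_le_two_le_split_of_four_le M hL hK hd hn hge
    have hq := ncard_three_eRk_le_one_le_one_of_le_five M hL hK hd hn (by omega)
    have h4 : {P : Set α | P ⊆ M.E ∧ P.ncard = 2 ∧ M.Dep P}.ncard = 4 := by omega
    rw [h4] at hs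
    omega
  · exact (ncard_four_eRk_le_two_le_of_five_le M hL hK hd hn hge').trans (by norm_num)

end S1CF

end PercRepro
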